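import Summits.Ventures.HSemireg.WedgeHankelRecurrenceGaussThreeTerm

/-!
# Venture HSemireg — **THE CHRISTOFFEL–DARBOUX IDENTITY for a three-term recurrence**: if `q_0 = 1`, `q_1 = X − a_0`, `q_{n+2} = (X − a_{n+1}) q_{n+1} − b_{n+1} q_n`, then
# `(x − y) Σ_{k ≤ n} (b_{k+1} ⋯ b_n) q_k(x) q_k(y) = q_{n+1}(x) q_n(y) − q_n(x) q_{n+1}(y)`, its CONFLUENT form `Σ_{k ≤ n} (b_{k+1} ⋯ b_n) q_k(x)² = q_{n+1}′(x) q_n(x) − q_n′(x) q_{n+1}(x)`, and,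
# for positive `b_j`: the right-hand side is `> 0` everywhere, so consecutive `q_n, q_{n+1}` have no common zero and `q_{n+1}` has only simple real zeros

HONEST FRAMING. Part of the Lean index of the computation cell `pub-hsemireg` (seat p10 gen 42, Sunday typer «UNIFORM-IN-n»).  Real polynomials only (`Polynomial.funext`,
`Polynomial.derivative`); no variety, no cohomology theory, no sheaf, no Ext group and no semiregularity map is constructed here; nothing here says that HC / HC_CM / HC_AV holds; no Literature
fact (unproved `Prop`) is declared or used.  Custodian versions as in `WedgeHankelSiegelIdeal` (1/3).
SOURCES (cited).  G. Szegő, *Orthogonal Polynomials*, AMS Colloq. Publ. 23, Thm 3.2.2 (Christoffel–Darboux formula (3.2.3)) and (3.2.4) (the confluent form), §3.3 (proof of Thm 3.3.1 ∕ 3.3.2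
from (3.2.4)); T. S. Chihara, *An Introduction to Orthogonal Polynomials* (1978), Ch. I Thm 4.5 (Christoffel–Darboux for a monic OPS, `Σ P_k(x)P_k(u)/(λ_1⋯λ_{k+1})` form) and Thm 4.6;
the recurrence itself is N273 (Szegő Thm 3.2.1).
PROOF TYPED HERE.  Induction on `n`: `D_{n+1} = (x − y) q_{n+1}(x) q_{n+1}(y) + b_{n+1} D_n` straight from the recurrence, and `Σ_{k ≤ n+1} = q_{n+1} q_{n+1} + b_{n+1} Σ_{k ≤ n}`
(`Finset.prod_Ico_succ_top`).  Confluent form: the pointwise identity in `x` is a polynomial identity (`Polynomial.funext`), differentiate and evaluate at `y`.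
DEDUP DISCLOSURE (`rg -n 'christoffel_darboux' Summits Literature`, 2026-09-02): `Summit.Ventures.HodgeRepro2.T5SU11LegendreIdentities.christoffel_darboux` ∕ `_confluent` are the
LEGENDRE special case (explicit `P_n`, other namespace, not importable here without pulling that venture); the general recurrence form below is new, and its names carry the prefix
`recurrence_` to keep short names distinct.  The 6 names below: 0 hits tree-wide.

WHAT IS IN THE TREE.  Mathlib `Finset.sum_range_succ`, `Finset.prod_Ico_succ_top`, `Finset.Ico_self`, `Polynomial.funext`, `Polynomial.derivative_mul`, `Polynomial.eval_finset_sum`.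
THIS FILE (namespace `Summit.Ventures.HSemireg.Wedge.HankelOuter` continued; CHAINED on N273 (import only); 0 definitions):
* §1039 **`recurrence_christoffel_darboux`** (THE IDENTITY), `recurrence_christoffel_darboux_poly` (as an identity in `ℝ[X]` for fixed `y`), **`recurrence_christoffel_darboux_confluent`** (Szegő (3.2.4)),
  `recurrence_christoffel_darboux_confluent_pos` (`> 0` for positive `b_j`), `recurrence_no_common_root` (`q_n(x) = 0 ⇒ q_{n+1}(x) ≠ 0`), `recurrence_root_simple` (`q_{n+1}(x) = 0 ⇒ q_{n+1}′(x) ≠ 0`).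
CAVEATS.  Pure recurrence algebra — no measure; nothing Ext-side.  New names only.
-/

open Module Polynomial
open scoped Matrix Polynomial

namespace Summit.Ventures.HSemireg.Wedge.HankelOuter

/-! ## §1039. Christoffel–Darboux -/

/-- **THE CHRISTOFFEL–DARBOUX IDENTITY** for `q_0 = 1`, `q_1 = X − a_0`, `q_{n+2} = (X − a_{n+1}) q_{n+1} − b_{n+1} q_n`:
`(x − y) · Σ_{k ≤ n} (∏_{k < j ≤ n} b_j) q_k(x) q_k(y) = q_{n+1}(x) q_n(y) − q_n(x) q_{n+1}(y)`. [Szegő Thm 3.2.2; Chihara I Thm 4.5; this file, §1039] -/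
theorem recurrence_christoffel_darboux {q : ℕ → ℝ[X]} {a b : ℕ → ℝ} (hq0 : q 0 = 1) (hq1 : q 1 = Polynomial.X - C (a 0))
    (hrec : ∀ n, q (n + 2) = (Polynomial.X - C (a (n + 1))) * q (n + 1) - C (b (n + 1)) * q n) (n : ℕ) (x y : ℝ) :
    (x - y) * ∑ k ∈ Finset.range (n + 1), (∏ j ∈ Finset.Ico (k + 1) (n + 1), b j) * ((q k).eval x * (q k).eval y)
      = (q (n + 1)).eval x * (q n).eval y - (q n).eval x * (q (n + 1)).eval y := by
  induction n with
  | zero =>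
    rw [Finset.sum_range_one, Finset.Ico_self, Finset.prod_empty, one_mul, zero_add, hq1, hq0]
    simp only [eval_sub, eval_X, eval_C, eval_one]
    ring
  | succ n ih =>
    -- split off the top term and pull out `b_{n+1}`
    have hsplit : ∑ k ∈ Finset.range (n + 2), (∏ j ∈ Finset.Ico (k + 1) (n + 2), b j) * ((q k).eval x * (q k).eval y)
        = (q (n + 1)).eval x * (q (n + 1)).eval y + b (n + 1) * ∑ k ∈ Finset.range (n + 1), (∏ j ∈ Finset.Ico (k + 1) (n + 1), b j) * ((q k).eval x * (q k).eval y) := by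
      rw [Finset.sum_range_succ, Finset.Ico_self, Finset.prod_empty, one_mul, add_comm, Finset.mul_sum]
      congr 1
      refine Finset.sum_congr rfl fun k hk => ?_
      rw [Finset.prod_Ico_succ_top (by have := Finset.mem_range.1 hk; omega)]
      ring
    rw [hsplit, mul_add, show (x - y) * (b (n + 1) * ∑ k ∈ Finset.range (n + 1), (∏ j ∈ Finset.Ico (k + 1) (n + 1), b j) * ((q k).eval x * (q k).eval y))
      = b (n + 1) * ((x - y) * ∑ k ∈ Finset.range (n + 1), (∏ j ∈ Finset.Ico (k + 1) (n + 1), b j) * ((q k).eval x * (q k).eval y)) by ring, ih,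
      show n + 1 + 1 = n + 2 by ring, hrec n]
    simp only [eval_sub, eval_mul, eval_X, eval_C]
    ring

/-- **Christoffel–Darboux as a polynomial identity in `x`** (fixed `y`):
`(X − y) · Σ_{k ≤ n} (∏ b) q_k(y) · q_k = q_n(y) · q_{n+1} − q_{n+1}(y) · q_n`. [Szegő Thm 3.2.2; this file, §1039] -/
theorem recurrence_christoffel_darboux_poly {q : ℕ → ℝ[X]} {a b : ℕ → ℝ} (hq0 : q 0 = 1) (hq1 : q 1 = Polynomial.X - C (a 0))
    (hrec : ∀ n, q (n + 2) = (Polynomial.X - C (a (n + 1))) * q (n + 1) - C (b (n + 1)) * q n) (n : ℕ) (y : ℝ) :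
    (Polynomial.X - C y) * ∑ k ∈ Finset.range (n + 1), C ((∏ j ∈ Finset.Ico (k + 1) (n + 1), b j) * (q k).eval y) * q k
      = C ((q n).eval y) * q (n + 1) - C ((q (n + 1)).eval y) * q n := by
  refine Polynomial.funext fun x => ?_
  have h := recurrence_christoffel_darboux hq0 hq1 hrec n x y
  simp only [eval_mul, eval_sub, eval_X, eval_C, eval_finsetSum]
  rw [show ∑ k ∈ Finset.range (n + 1), (∏ j ∈ Finset.Ico (k + 1) (n + 1), b j) * (q k).eval y * (q k).eval x
      = ∑ k ∈ Finset.range (n + 1), (∏ j ∈ Finset.Ico (k + 1) (n + 1), b j) * ((q k).eval x * (q k).eval y) from Finset.sum_congr rfl fun k _ => by ring, h]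
  ring

/-- **THE CONFLUENT CHRISTOFFEL–DARBOUX IDENTITY**: `Σ_{k ≤ n} (∏_{k < j ≤ n} b_j) q_k(y)² = q_{n+1}′(y) q_n(y) − q_n′(y) q_{n+1}(y)`. [Szegő (3.2.4); Chihara I Thm 4.6; this file, §1039] -/
theorem recurrence_christoffel_darboux_confluent {q : ℕ → ℝ[X]} {a b : ℕ → ℝ} (hq0 : q 0 = 1) (hq1 : q 1 = Polynomial.X - C (a 0))
    (hrec : ∀ n, q (n + 2) = (Polynomial.X - C (a (n + 1))) * q (n + 1) - C (b (n + 1)) * q n) (n : ℕ) (y : ℝ) :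
    ∑ k ∈ Finset.range (n + 1), (∏ j ∈ Finset.Ico (k + 1) (n + 1), b j) * ((q k).eval y) ^ 2
      = (derivative (q (n + 1))).eval y * (q n).eval y - (derivative (q n)).eval y * (q (n + 1)).eval y := by
  have h := recurrence_christoffel_darboux_poly hq0 hq1 hrec n y
  have hd := congrArg (fun P => (derivative P).eval y) h
  simp only [derivative_mul, derivative_sub, derivative_X, derivative_C, sub_zero, one_mul, zero_mul, zero_add, eval_add, eval_mul, eval_sub, eval_X, eval_C, sub_self,
    eval_finsetSum] at hd
  rw [show ∑ k ∈ Finset.range (n + 1), (∏ j ∈ Finset.Ico (k + 1) (n + 1), b j) * ((q k).eval y) ^ 2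
      = ∑ k ∈ Finset.range (n + 1), (∏ j ∈ Finset.Ico (k + 1) (n + 1), b j) * (q k).eval y * (q k).eval y from Finset.sum_congr rfl fun k _ => by ring]
  linarith

/-- **Positivity of the confluent form**: if every `b_j > 0` then `q_{n+1}′(y) q_n(y) − q_n′(y) q_{n+1}(y) > 0` for all real `y` (the `k = 0` term is `∏ b_j > 0`). [Szegő §3.3; this file, §1039] -/
theorem recurrence_christoffel_darboux_confluent_pos {q : ℕ → ℝ[X]} {a b : ℕ → ℝ} (hq0 : q 0 = 1) (hq1 : q 1 = Polynomial.X - C (a 0))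
    (hrec : ∀ n, q (n + 2) = (Polynomial.X - C (a (n + 1))) * q (n + 1) - C (b (n + 1)) * q n) (hb : ∀ j, 0 < b j) (n : ℕ) (y : ℝ) :
    0 < (derivative (q (n + 1))).eval y * (q n).eval y - (derivative (q n)).eval y * (q (n + 1)).eval y := by
  rw [← recurrence_christoffel_darboux_confluent hq0 hq1 hrec n y]
  have hnn : ∀ k ∈ Finset.range (n + 1), 0 ≤ (∏ j ∈ Finset.Ico (k + 1) (n + 1), b j) * ((q k).eval y) ^ 2 :=
    fun k _ => mul_nonneg (Finset.prod_nonneg fun j _ => (hb j).le) (sq_nonneg _)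
  refine lt_of_lt_of_le ?_ (Finset.single_le_sum hnn (Finset.mem_range.2 (Nat.succ_pos n)))
  rw [hq0, eval_one, one_pow, mul_one]
  exact Finset.prod_pos fun j _ => hb j

/-- **Consecutive terms have no common zero** (positive `b_j`): `q_n(y) = 0 ⇒ q_{n+1}(y) ≠ 0`. [Szegő Thm 3.3.2 via (3.2.4); this file, §1039] -/
theorem recurrence_no_common_root {q : ℕ → ℝ[X]} {a b : ℕ → ℝ} (hq0 : q 0 = 1) (hq1 : q 1 = Polynomial.X - C (a 0))
    (hrec : ∀ n, q (n + 2) = (Polynomial.X - C (a (n + 1))) * q (n + 1) - C (b (n + 1)) * q n) (hb : ∀ j, 0 < b j) (n : ℕ) {y : ℝ} (hy : (q n).eval y = 0) :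
    (q (n + 1)).eval y ≠ 0 := fun h => by
  have := recurrence_christoffel_darboux_confluent_pos hq0 hq1 hrec hb n y
  rw [hy, h, mul_zero, mul_zero, sub_zero] at this
  exact lt_irrefl _ this

/-- **Zeros of `q_{n+1}` are simple** (positive `b_j`): `q_{n+1}(y) = 0 ⇒ q_{n+1}′(y) ≠ 0`. [Szegő Thm 3.3.1 via (3.2.4); this file, §1039] -/
theorem recurrence_root_simple {q : ℕ → ℝ[X]} {a b : ℕ → ℝ} (hq0 : q 0 = 1) (hq1 : q 1 = Polynomial.X - C (a 0))
    (hrec : ∀ n, q (n + 2) = (Polynomial.X - C (a (n + 1))) * q (n + 1) - C (b (n + 1)) * q n) (hb : ∀ j, 0 < b j) (n : ℕ) {y : ℝ} (hy : (q (n + 1)).eval y = 0) :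
    (derivative (q (n + 1))).eval y ≠ 0 := fun h => by
  have := recurrence_christoffel_darboux_confluent_pos hq0 hq1 hrec hb n y
  rw [hy, h, zero_mul, mul_zero, sub_zero] at this
  exact lt_irrefl _ this

end Summit.Ventures.HSemireg.Wedge.HankelOuter
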